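import Mathlib
import HarnessLib
import Literature.Probability.MarkovChains.BottleneckRatio

/-!
# `|λ|ᵗ ≤ 2d(t)` and the eigenvalue lower bound `t_mix(ε) ≥ (1/(1−|λ|) − 1) log(1/(2ε))` (Levin–Peres–Wilmer, Theorem 12.5)

HONEST FRAMING: exact (Metropolis-corrected) sampling algorithms for lattice gauge theory; figures
of merit are autocorrelation/cost numbers at stated couplings and volumes; no continuum-physics claim.

Conventions of `TotalVariation.lean` / `BottleneckRatio.lean` (finite `X`, ROW kernel
`P : X → X → ℝ`, `Pᵗ(x,·) = lawAt P (Pi.single x 1) t`, `d(t) = worstTvDist P π t`,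
`t_mix(ε) = mixingTime P π ε`).  Source: D. A. Levin, Y. Peres (with E. L. Wilmer), *Markov Chains
and Mixing Times*, 2nd ed., AMS 2017 [LevinPeres2017], §12.1–12.2.  Everything is PROVED (finite
sums; 0 named facts; no definition is introduced).

An EIGENFUNCTION of the transition matrix with eigenvalue `λ` is `f` with `Pf = λf`, `(Pf)(x) =
Σ_y P(x,y) f(y)` [cite: LevinPeres2017, §12.1 (first paragraph)]; "if `P` is not reversible, the
eigenfunctions and eigenvalues may not be real", so `f : X → ℂ`, `λ : ℂ` throughout, written as the
explicit hypotheses `(hf : ∀ x, Σ_y P x y · f y = λ · f x)`, `f ≠ 0` (`hasEigenvector_iff` relates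
them to Mathlib's `Module.End.HasEigenvector` of `Matrix.toLin'`).

* `norm_eigenvalue_le_one` — **Lemma 12.1 (i)**: `|λ| ≤ 1` for a row-stochastic `P`
  [cite: LevinPeres2017, §12.1 Lemma 12.1 (i)];
* `sum_mul_eigenfunction_eq_zero` — **Lemma 12.3**: `E_π(f) = 0` when `λ ≠ 1` and `πP = π` ("does
  not require reversibility") [cite: LevinPeres2017, §12.1 Lemma 12.3];
* `sum_kernel_mul_eigenfunction` — `Pᵗf = λᵗf`;
* `norm_eigenvalue_pow_le_two_mul_worstTvDist` — **eq. (12.15)**: `|λ|ᵗ ≤ 2d(t)` (`λ ≠ 1`, `πP = π`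
  a probability vector) [cite: LevinPeres2017, §12.2, proof of Thm 12.5, eq. (12.15)];
* `LevinPeres2017_thm_12_5` — **Theorem 12.5**: every `t` with `d(t) ≤ ε` (`ε > 0`) satisfies
  `(1/(1−|λ|) − 1)·log(1/(2ε)) ≤ t` for every eigenvalue `λ ≠ 1` with `|λ| < 1`; and
  `LevinPeres2017_thm_12_5_tmix`, the same with `t = t_mix(ε)` for a chain that is `ε`-close at
  some time [cite: LevinPeres2017, §12.2 Thm 12.5 (first display)].  The book's standing hypothesis
  "irreducible and aperiodic" enters only through `|λ| < 1` for `λ ≠ 1`, which is taken as the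
  hypothesis here; the reversible corollary `t_mix(ε) ≥ (t_rel − 1) log(1/(2ε))` [eq. (12.14)] is
  the case `|λ| = λ⋆` and is not typed separately (no `λ⋆`/`t_rel` is defined here).

Proof = the printed one: `|λᵗ f(x)| = |Pᵗf(x)| = |Σ_y [Pᵗ(x,y) − π(y)] f(y)| ≤ ‖f‖_∞ · 2d(t)`, take
`x` with `|f(x)| = ‖f‖_∞`; then `|λ|^{t} ≤ 2ε` and `log(1/|λ|) ≤ 1/|λ| − 1`.
-/

namespace Literature.Probability.MarkovChains

open Finset

variable {X : Type*} [Fintype X] [DecidableEq X]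

/-- The explicit eigen-equation `∀ x, Σ_y P(x,y) f(y) = λ f(x)` with `f ≠ 0` is Mathlib's
`Module.End.HasEigenvector` for the linear map of the complexified matrix.
[cite: LevinPeres2017, §12.1 (definition of eigenfunction, `Pf = λf`)] -/
theorem hasEigenvector_iff (P : X → X → ℝ) (f : X → ℂ) (lam : ℂ) :
    Module.End.HasEigenvector (Matrix.toLin' (fun x y => (P x y : ℂ))) lam f ↔
      f ≠ 0 ∧ ∀ x, ∑ y, (P x y : ℂ) * f y = lam * f x := by
  rw [Module.End.hasEigenvector_iff, Module.End.mem_eigenspace_iff, Matrix.toLin'_apply, and_comm]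
  refine and_congr Iff.rfl ⟨fun h x => ?_, fun h => ?_⟩
  · have := congrFun h x
    simpa [Matrix.mulVec, dotProduct] using this
  · funext x
    simpa [Matrix.mulVec, dotProduct] using h x

omit [DecidableEq X] in
/-- **Lemma 12.1 (i)**: every eigenvalue of a (row-)stochastic matrix has `|λ| ≤ 1`.
[cite: LevinPeres2017, §12.1 Lemma 12.1 (i)] -/
theorem norm_eigenvalue_le_one {P : X → X → ℝ} (hP : IsRowStochastic P) {f : X → ℂ} {lam : ℂ}
    (hf : ∀ x, ∑ y, (P x y : ℂ) * f y = lam * f x) (hf0 : f ≠ 0) : ‖lam‖ ≤ 1 := by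
  obtain ⟨x₁, hx₁⟩ : ∃ x, f x ≠ 0 := Function.ne_iff.mp hf0
  obtain ⟨x, -, hx⟩ := exists_max_image univ (fun x => ‖f x‖) ⟨x₁, mem_univ _⟩
  have hfx : 0 < ‖f x‖ := (norm_pos_iff.mpr hx₁).trans_le (hx x₁ (mem_univ _))
  have h1 : ‖lam‖ * ‖f x‖ ≤ 1 * ‖f x‖ := by
    calc ‖lam‖ * ‖f x‖ = ‖∑ y, (P x y : ℂ) * f y‖ := by rw [← norm_mul, ← hf x]
      _ ≤ ∑ y, ‖(P x y : ℂ) * f y‖ := norm_sum_le _ _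
      _ = ∑ y, P x y * ‖f y‖ := sum_congr rfl fun y _ => by
          rw [norm_mul, Complex.norm_real, Real.norm_of_nonneg (hP.1 x y)]
      _ ≤ ∑ y, P x y * ‖f x‖ :=
          sum_le_sum fun y _ => mul_le_mul_of_nonneg_left (hx y (mem_univ _)) (hP.1 x y)
      _ = 1 * ‖f x‖ := by rw [← sum_mul, hP.2 x]
  exact le_of_mul_le_mul_right h1 hfx

omit [DecidableEq X] in
/-- **Lemma 12.3**: an eigenfunction with eigenvalue `λ ≠ 1` has `E_π(f) = Σ_x π(x) f(x) = 0`
whenever `πP = π` ("does not require reversibility": multiply `Pf = λf` on the left by `π`).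
[cite: LevinPeres2017, §12.1 Lemma 12.3] -/
theorem sum_mul_eigenfunction_eq_zero {P : X → X → ℝ} {π : X → ℝ} (hπ : IsStationary π P)
    {f : X → ℂ} {lam : ℂ} (hf : ∀ x, ∑ y, (P x y : ℂ) * f y = lam * f x) (hlam : lam ≠ 1) :
    ∑ x, (π x : ℂ) * f x = 0 := by
  -- `E_π(f) = π P f = λ E_π(f)`
  have h : ∑ x, (π x : ℂ) * f x = lam * ∑ x, (π x : ℂ) * f x := by
    calc ∑ x, (π x : ℂ) * f x = ∑ y, (∑ x, (π x : ℂ) * (P x y : ℂ)) * f y :=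
          sum_congr rfl fun y _ => by rw [← hπ y]; push_cast; rfl
      _ = ∑ x, (π x : ℂ) * ∑ y, (P x y : ℂ) * f y := by
          simp_rw [sum_mul, mul_sum, mul_assoc]
          rw [sum_comm]
      _ = ∑ x, (π x : ℂ) * (lam * f x) := sum_congr rfl fun x _ => by rw [hf x]
      _ = lam * ∑ x, (π x : ℂ) * f x := by
          rw [mul_sum]; exact sum_congr rfl fun x _ => by ring
  have h2 : (lam - 1) * ∑ x, (π x : ℂ) * f x = 0 := by rw [sub_mul, one_mul, ← h, sub_self]
  rcases mul_eq_zero.mp h2 with h3 | h3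
  · exact absurd (sub_eq_zero.mp h3) hlam
  · exact h3

omit [DecidableEq X] in
/-- `μP^{1+t} = (μP¹)Pᵗ` (iterate). [folklore] -/
private theorem lawAt_one_add (P : X → X → ℝ) (μ : X → ℝ) (t : ℕ) :
    lawAt P μ (1 + t) = lawAt P (lawAt P μ 1) t := by
  unfold lawAt; rw [add_comm, Function.iterate_add_apply]

/-- `δ_x P = P(x,·)`. [folklore] -/
private theorem lawAt_single_one (P : X → X → ℝ) (x z : X) :
    lawAt P (Pi.single x 1) 1 z = P x z := by
  show stepLaw P (Pi.single x 1) z = P x z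
  unfold stepLaw
  rw [Finset.sum_eq_single x (fun y _ hy => by rw [Pi.single_apply, if_neg hy, zero_mul])
    (fun h => absurd (mem_univ x) h)]
  simp

/-- `Pᵗf = λᵗf` pointwise: `Σ_y Pᵗ(x,y) f(y) = λᵗ f(x)`.
[cite: LevinPeres2017, §12.1 (`Pᵗ f_j = λ_jᵗ f_j`, proof of Lemma 12.2)] -/
theorem sum_kernel_mul_eigenfunction {P : X → X → ℝ} {f : X → ℂ} {lam : ℂ}
    (hf : ∀ x, ∑ y, (P x y : ℂ) * f y = lam * f x) (t : ℕ) (x : X) :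
    ∑ y, (lawAt P (Pi.single x 1) t y : ℂ) * f y = lam ^ t * f x := by
  induction t generalizing x with
  | zero =>
    simp only [lawAt_zero, Pi.single_apply, pow_zero, one_mul]
    rw [Finset.sum_eq_single x (fun y _ hy => by rw [if_neg hy]; simp) (fun h => absurd (mem_univ x) h)]
    simp
  | succ t ih =>
    -- `P^{t+1}(x,y) = Σ_z P(x,z) Pᵗ(z,y)`: first-step decomposition via linearity in the start
    have hstep : ∀ y, lawAt P (Pi.single x 1) (t + 1) y = ∑ z, P x z * lawAt P (Pi.single z 1) t y := by
      intro y
      rw [add_comm, lawAt_one_add, lawAt_eq_sum_mul_lawAt_single]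
      refine sum_congr rfl fun z _ => ?_
      rw [lawAt_single_one]
    calc ∑ y, (lawAt P (Pi.single x 1) (t + 1) y : ℂ) * f y
        = ∑ y, (∑ z, (P x z : ℂ) * (lawAt P (Pi.single z 1) t y : ℂ)) * f y :=
          sum_congr rfl fun y _ => by rw [hstep y]; push_cast; rfl
      _ = ∑ z, (P x z : ℂ) * ∑ y, (lawAt P (Pi.single z 1) t y : ℂ) * f y := by
          simp_rw [sum_mul, mul_sum, mul_assoc]; rw [sum_comm]
      _ = ∑ z, (P x z : ℂ) * (lam ^ t * f z) := sum_congr rfl fun z _ => by rw [ih z]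
      _ = lam ^ t * ∑ z, (P x z : ℂ) * f z := by
          rw [mul_sum]; exact sum_congr rfl fun z _ => by ring
      _ = lam ^ (t + 1) * f x := by rw [hf x]; ring

/-- **Eq. (12.15): `|λ|ᵗ ≤ 2·d(t)`** for every eigenvalue `λ ≠ 1` (eigenfunction `f ≠ 0`) of a
row-stochastic `P` with stationary probability vector `π`:
`|λᵗf(x)| = |Σ_y [Pᵗ(x,y) − π(y)] f(y)| ≤ ‖f‖_∞ · 2d(t)` at a maximiser `x` of `|f|`.
[cite: LevinPeres2017, §12.2, proof of Thm 12.5, eq. (12.15)] -/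
theorem norm_eigenvalue_pow_le_two_mul_worstTvDist {P : X → X → ℝ}
    {π : X → ℝ} (hπ : IsStationary π P) {f : X → ℂ} {lam : ℂ}
    (hf : ∀ x, ∑ y, (P x y : ℂ) * f y = lam * f x) (hf0 : f ≠ 0) (hlam : lam ≠ 1) (t : ℕ) :
    ‖lam‖ ^ t ≤ 2 * worstTvDist P π t := by
  obtain ⟨x₁, hx₁⟩ : ∃ x, f x ≠ 0 := Function.ne_iff.mp hf0
  obtain ⟨x, -, hx⟩ := exists_max_image univ (fun x => ‖f x‖) ⟨x₁, mem_univ _⟩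
  have hfx : 0 < ‖f x‖ := (norm_pos_iff.mpr hx₁).trans_le (hx x₁ (mem_univ _))
  set L : X → ℝ := lawAt P (Pi.single x 1) t with hL
  -- `λᵗ f(x) = Σ_y (Pᵗ(x,y) − π(y)) f(y)` (Lemma 12.3 removes the `π` term)
  have hkey : lam ^ t * f x = ∑ y, ((L y : ℂ) - (π y : ℂ)) * f y := by
    rw [← sum_kernel_mul_eigenfunction hf t x]
    simp only [sub_mul, sum_sub_distrib, sum_mul_eigenfunction_eq_zero hπ hf hlam, sub_zero, hL]
  have h1 : ‖lam‖ ^ t * ‖f x‖ ≤ 2 * worstTvDist P π t * ‖f x‖ := by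
    calc ‖lam‖ ^ t * ‖f x‖ = ‖∑ y, ((L y : ℂ) - (π y : ℂ)) * f y‖ := by
          rw [← norm_pow, ← norm_mul, hkey]
      _ ≤ ∑ y, ‖((L y : ℂ) - (π y : ℂ)) * f y‖ := norm_sum_le _ _
      _ = ∑ y, |L y - π y| * ‖f y‖ := sum_congr rfl fun y _ => by
          rw [norm_mul, ← Complex.ofReal_sub, Complex.norm_real, Real.norm_eq_abs]
      _ ≤ ∑ y, |L y - π y| * ‖f x‖ :=
          sum_le_sum fun y _ => mul_le_mul_of_nonneg_left (hx y (mem_univ _)) (abs_nonneg _)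
      _ = 2 * tvDist L π * ‖f x‖ := by
          rw [← sum_mul]; unfold tvDist; ring
      _ ≤ 2 * worstTvDist P π t * ‖f x‖ :=
          mul_le_mul_of_nonneg_right
            (mul_le_mul_of_nonneg_left (tvDist_single_le_worstTvDist P π t x) (by norm_num))
            (norm_nonneg _)
  exact le_of_mul_le_mul_right h1 hfx

/-- **Theorem 12.5**: for a row-stochastic `P` with stationary probability vector `π` and an
eigenvalue `λ ≠ 1` with `|λ| < 1` (automatic for an irreducible aperiodic chain), every time `t`
with `d(t) ≤ ε`, `ε > 0`, satisfies `(1/(1 − |λ|) − 1) · log(1/(2ε)) ≤ t`.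
[cite: LevinPeres2017, §12.2 Thm 12.5 (first display)] -/
theorem LevinPeres2017_thm_12_5 {P : X → X → ℝ} {π : X → ℝ}
    (hπ : IsStationary π P) {f : X → ℂ} {lam : ℂ}
    (hf : ∀ x, ∑ y, (P x y : ℂ) * f y = lam * f x) (hf0 : f ≠ 0) (hlam : lam ≠ 1)
    (hlam1 : ‖lam‖ < 1) {ε : ℝ} (hε : 0 < ε) {t : ℕ} (ht : worstTvDist P π t ≤ ε) :
    (1 / (1 - ‖lam‖) - 1) * Real.log (1 / (2 * ε)) ≤ t := by
  set r : ℝ := ‖lam‖ with hr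
  have hr0 : 0 ≤ r := norm_nonneg _
  have h1r0 : 1 - r ≠ 0 := ne_of_gt (by linarith)
  have hfac : 1 / (1 - r) - 1 = r / (1 - r) := by
    field_simp
    ring
  have hfac0 : 0 ≤ 1 / (1 - r) - 1 := by rw [hfac]; exact div_nonneg hr0 (by linarith)
  -- `r^t ≤ 2ε`
  have hrt : r ^ t ≤ 2 * ε :=
    (norm_eigenvalue_pow_le_two_mul_worstTvDist hπ hf hf0 hlam t).trans (by linarith)
  rcases le_or_gt 1 (2 * ε) with h2ε | h2ε
  · -- `log(1/(2ε)) ≤ 0`: the bound is trivial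
    have hlog : Real.log (1 / (2 * ε)) ≤ 0 :=
      Real.log_nonpos (by positivity) (by rw [div_le_one (by positivity)]; exact h2ε)
    exact (mul_nonpos_of_nonneg_of_nonpos hfac0 hlog).trans (Nat.cast_nonneg t)
  · rcases hr0.eq_or_lt with hr00 | hrpos
    · -- `λ = 0`: the factor vanishes
      rw [← hr00]; norm_num
    · -- `t·log(1/r) ≥ log(1/(2ε))` and `log(1/r) ≤ 1/r − 1 = (1 − r)/r`
      have hlogle : (t : ℝ) * Real.log r ≤ Real.log (2 * ε) := by
        rw [← Real.log_pow]
        exact Real.log_le_log (pow_pos hrpos t) hrt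
      have hloginv : Real.log (1 / r) ≤ 1 / r - 1 := Real.log_le_sub_one_of_pos (by positivity)
      have hlog1r : Real.log (1 / r) = -Real.log r := by rw [one_div, Real.log_inv]
      have hlog2e : Real.log (1 / (2 * ε)) = -Real.log (2 * ε) := by rw [one_div, Real.log_inv]
      have hlogpos : 0 < Real.log (1 / (2 * ε)) := Real.log_pos (by
        rw [lt_div_iff₀ (by positivity)]; linarith)
      -- combine: `log(1/(2ε)) ≤ t · log(1/r) ≤ t · (1 − r)/r`
      have h3 : Real.log (1 / (2 * ε)) ≤ (t : ℝ) * ((1 - r) / r) := by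
        have h4 : Real.log (1 / (2 * ε)) ≤ (t : ℝ) * Real.log (1 / r) := by
          rw [hlog1r, hlog2e]; linarith
        have h5 : (t : ℝ) * Real.log (1 / r) ≤ (t : ℝ) * ((1 - r) / r) := by
          refine mul_le_mul_of_nonneg_left (hloginv.trans_eq ?_) (Nat.cast_nonneg t)
          field_simp
        exact h4.trans h5
      rw [hfac]
      -- `r/(1−r) · log(1/(2ε)) ≤ t` ⇔ `log(1/(2ε)) ≤ t (1−r)/r`
      have h1r : 0 < 1 - r := by linarith
      calc r / (1 - r) * Real.log (1 / (2 * ε))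
          ≤ r / (1 - r) * ((t : ℝ) * ((1 - r) / r)) :=
            mul_le_mul_of_nonneg_left h3 (div_nonneg hr0 h1r.le)
        _ = t := by field_simp

/-- **Theorem 12.5 for `t_mix(ε)`**: `(1/(1 − |λ|) − 1)·log(1/(2ε)) ≤ t_mix(ε)` for a chain that is
`ε`-close at some time (row-stochastic `P`, stationary probability vector `π`, eigenvalue `λ ≠ 1`
with `|λ| < 1`, `ε > 0`). [cite: LevinPeres2017, §12.2 Thm 12.5 (first display)] -/
theorem LevinPeres2017_thm_12_5_tmix {P : X → X → ℝ} {π : X → ℝ}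
    (hπ : IsStationary π P) {f : X → ℂ} {lam : ℂ}
    (hf : ∀ x, ∑ y, (P x y : ℂ) * f y = lam * f x) (hf0 : f ≠ 0) (hlam : lam ≠ 1)
    (hlam1 : ‖lam‖ < 1) {ε : ℝ} (hε : 0 < ε) (hmix : ∃ t, worstTvDist P π t ≤ ε) :
    (1 / (1 - ‖lam‖) - 1) * Real.log (1 / (2 * ε)) ≤ (mixingTime P π ε : ℝ) := by
  obtain ⟨t₀, ht₀⟩ := hmix
  exact LevinPeres2017_thm_12_5 hπ hf hf0 hlam hlam1 hε (worstTvDist_mixingTime_le P π ht₀)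

end Literature.Probability.MarkovChains
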